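import Mathlib
import Summits.CriticalPhenomena.PercolationContinuityZ3.Theorems.PercNearOneGluingNoHeavyLowerTailStarLemmaBlocks

/-!
# Crux `PercNearOneGluing.NoHeavyLowerTail` (stmt-CriticalPhenomena-4575), line `bhk-superadditivity-thinning` —
# the Block Star Lemma over an arbitrary finite unit set (stub `starLemmaBlocks_finset`)

Lead `prover-line-stmt-CriticalPhenomena-4575-c3-0`, 2026-08-16; lands with `--supports stmt-CriticalPhenomena-4575`.

`starLemmaBlocks` (file `PercNearOneGluingNoHeavyLowerTailStarLemmaBlocks`) is the law-level first-hit charging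
inequality with TRUE budgets (rescue through block-mates), the units being indexed by `Finset.range k` with
priority to larger indices, under the block-exchange hypothesis at every level.  Here the same inequality is
stated for an arbitrary unit set `U : Finset α` carrying a rank function `rank : α → ℕ` that is injective on
`U` (priority to larger rank; the hit weight of `a` is `q a * ∏_{a' ∈ U, rank a < rank a'} (1 - q a')`), the
alive sets `L ω ⊆ α` and the blocks `cl ω a` of the dead units, which is the form needed to apply it to relay
sets in percolation.

The proof is a pure transport along the rank compression `g a = #{a' ∈ U | rank a' < rank a}` (a rank-monotone
bijection from `U` onto `range #U`, inverse `f` on `U`): we apply `starLemmaBlocks'` to the coins `q ∘ f`, the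
alive sets `L' ω = {j < #U | f j ∈ L ω}` and the blocks `cl' ω j = {i < #U | f i ∈ cl ω (f j)}` (`j < #U`;
`{j}` for `j ≥ #U`), check that the three block axioms and the block-exchange hypothesis transport (the latter
at `m = f m'`, `Z = f '' Z'`, `h = f h'`), and rewrite every sum and product along the bijection
(`Finset.prod_nbij'`, `Finset.sum_nbij'`); the filter `{a' ∈ U | rank a < rank a'}` corresponds to
`Finset.Ico (g a + 1) #U`.
-/

namespace Summit.CriticalPhenomena.PercolationContinuityZ3.Theorems

open Finset

open scoped BigOperators

/-- **The Block Star Lemma over a finite unit set** (stub `starLemmaBlocks_finset` of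
stmt-CriticalPhenomena-4575).  Units `a ∈ U` carry independent entrance coins of weights `q a ∈ [0,1]` and an
injective priority `rank`; `(s, p)` is a finitely supported nonnegative law of the random alive set `L ω`
together with the blocks `cl ω a` of the dead units (`a ∈ cl ω a`; blocks of dead units avoid `L ω`; a unit in
the block of a dead unit has the same block).  Under the block-exchange hypothesis — for `m ∈ U`, every coin
pattern `Z` of units of rank below `rank m` and every `h ∈ U` of rank below `rank m`,
`Σ_ω p ω 1{m ∈ L, h ∉ L, Z ∩ L = ∅, Z ∩ cl h ≠ ∅} ≤ Σ_ω p ω 1{m ∉ L, Z ∩ cl m = ∅, Z ∩ L ≠ ∅, h ∉ cl m}` — the bad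
mass `Σ_ω p ω (∏_{a ∈ U} (1 - q a 1{a ∈ L ω}) - ∏_{a ∈ U} (1 - q a))` is at most the hit-weighted sum of the
true unreliabilities `Σ_ω p ω 1{a ∉ L ω} (Πcl + ΠL - Πcl ΠL)`, the hit weight of `a` being
`q a ∏_{a' ∈ U, rank a < rank a'} (1 - q a')`.  Transported from `starLemmaBlocks'` along the rank
compression of `U`. -/
theorem starLemmaBlocks_finset : ∀ {Ω α : Type*} [DecidableEq α] (s : Finset Ω) (p : Ω → ℝ), (∀ ω ∈ s, 0 ≤ p ω) → ∀ (U : Finset α) (rank : α → ℕ), Set.InjOn rank (↑U : Set α) → ∀ (L : Ω → Finset α) (cl : Ω → α → Finset α), (∀ ω ∈ s, ∀ a ∈ U, a ∈ cl ω a) → (∀ ω ∈ s, ∀ a ∈ U, a ∉ L ω → Disjoint (cl ω a) (L ω)) → (∀ ω ∈ s, ∀ a ∈ U, ∀ a' ∈ U, a' ∉ L ω → a ∈ cl ω a' → cl ω a = cl ω a') → ∀ (q : α → ℝ), (∀ a, 0 ≤ q a) → (∀ a, q a ≤ 1) → (∀ m ∈ U, ∀ (Z : Finset α), Z ⊆ U.filter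 (fun a => rank a < rank m) → ∀ h ∈ U, rank h < rank m → (∑ ω ∈ s, p ω * (if m ∈ L ω ∧ h ∉ L ω ∧ Disjoint Z (L ω) ∧ ¬ Disjoint Z (cl ω h) then (1 : ℝ) else 0)) ≤ ∑ ω ∈ s, p ω * (if m ∉ L ω ∧ Disjoint Z (cl ω m) ∧ ¬ Disjoint Z (L ω) ∧ h ∉ cl ω m then (1 : ℝ) else 0)) → (Finset.sum s (fun ω => p ω * ((Finset.prod U (fun a => if a ∈ L ω then (1 : ℝ) - q a else 1)) - (Finset.prod U (fun a => (1 : ℝ) - q a))))) ≤ ∑ a ∈ U, ((q a) * Finset.prod (U.filter (fun a' => rank a < rank a')) (fun a' => (1 : ℝ) - q a')) * (Finset.sum s (fun ω => p ω * (if a ∈ L ω then (0 : ℝ) else ((Finset.prod U (fun a' => if a' ∈ cl ω a then (1 : ℝ) - q a' else 1)) + (Finset.prod U (fun a' => if a' ∈ L ω then (1 : ℝ) - q a' else 1)) - (Finset.prod U (fun a' => if a' ∈ cl ω a then (1 : ℝ) - q a' else 1)) * (Finset.prod U (fun a' => if a' ∈ L ω then (1 : ℝ) - q a' else 1)))))) :=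 by
  intro Ω α _ s p hp U rank hrank L cl hselfU hdisjU hblkU q hq0 hq1 hBXU
  rcases Finset.eq_empty_or_nonempty U with hU | ⟨a₀, ha₀⟩
  · subst hU
    simp
  haveI : Nonempty α := ⟨a₀⟩
  -- Step 1: the rank compression `g a = #{a' ∈ U | rank a' < rank a}`.
  obtain ⟨g, hg_ltk, hg_lt⟩ : ∃ g : α → ℕ, (∀ a ∈ U, g a < U.card) ∧
      (∀ a ∈ U, ∀ a' ∈ U, rank a < rank a' → g a < g a') := by
    refine ⟨fun a => (U.filter (fun a' => rank a' < rank a)).card, fun a ha => ?_,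
      fun a ha a' ha' h => ?_⟩
    · exact Finset.card_lt_card (Finset.filter_ssubset.2 ⟨a, ha, lt_irrefl _⟩)
    · dsimp only
      apply Finset.card_lt_card
      refine (Finset.ssubset_iff_of_subset ?_).2 ⟨a, Finset.mem_filter.2 ⟨ha, h⟩, by simp⟩
      intro x hx
      rw [Finset.mem_filter] at hx ⊢
      exact ⟨hx.1, hx.2.trans h⟩
  -- `g` reflects the rank order and is injective on `U`.
  have hg_rank : ∀ a ∈ U, ∀ a' ∈ U, g a < g a' → rank a < rank a' := by
    intro a ha a' ha' h
    rcases lt_trichotomy (rank a) (rank a') with hlt | heq | hgt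
    · exact hlt
    · exact absurd (hrank (Finset.mem_coe.2 ha) (Finset.mem_coe.2 ha') heq ▸ h) (lt_irrefl _)
    · exact absurd (h.trans (hg_lt a' ha' a ha hgt)) (lt_irrefl _)
  have hg_inj : Set.InjOn g (↑U : Set α) := by
    intro a ha a' ha' h
    have ha₁ : a ∈ U := Finset.mem_coe.1 ha
    have ha₁' : a' ∈ U := Finset.mem_coe.1 ha'
    by_contra hne
    have hne' : rank a ≠ rank a' := fun heq => hne (hrank ha ha' heq)
    rcases Ne.lt_or_gt hne' with hlt | hlt
    · exact absurd h (hg_lt a ha₁ a' ha₁' hlt).ne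
    · exact absurd h (hg_lt a' ha₁' a ha₁ hlt).ne'
  -- `g` maps `U` onto `range #U`.
  have hg_img : U.image g = Finset.range U.card := by
    apply Finset.eq_of_subset_of_card_le
    · intro j hj
      obtain ⟨a, ha, rfl⟩ := Finset.mem_image.1 hj
      exact Finset.mem_range.2 (hg_ltk a ha)
    · rw [Finset.card_range, Finset.card_image_of_injOn hg_inj]
  -- Step 2: the inverse enumeration `f` of `U` by increasing rank.
  obtain ⟨f, hfg, hf⟩ : ∃ f : ℕ → α, (∀ a ∈ U, f (g a) = a) ∧
      (∀ j, j < U.card → f j ∈ U ∧ g (f j) = j) := by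
    refine ⟨Function.invFunOn g (↑U : Set α),
      fun a ha => hg_inj.leftInvOn_invFunOn (Finset.mem_coe.2 ha), fun j hj => ?_⟩
    have hj' : j ∈ U.image g := by
      rw [hg_img]
      exact Finset.mem_range.2 hj
    obtain ⟨a, ha, hga⟩ := Finset.mem_image.1 hj'
    have h := Function.invFunOn_pos (f := g) (s := (↑U : Set α)) (b := j) ⟨a, Finset.mem_coe.2 ha, hga⟩
    exact ⟨Finset.mem_coe.1 h.1, h.2⟩
  -- Step 3: the transported alive sets and blocks, with their membership lemmas.
  obtain ⟨L', hL'⟩ : ∃ L' : Ω → Finset ℕ, ∀ ω, L' ω = (Finset.range U.card).filter (fun j => f j ∈ L ω) :=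
    ⟨fun ω => (Finset.range U.card).filter (fun j => f j ∈ L ω), fun ω => rfl⟩
  obtain ⟨cl', hcl'lt, hcl'ge⟩ : ∃ cl' : Ω → ℕ → Finset ℕ,
      (∀ ω j, j < U.card → cl' ω j = (Finset.range U.card).filter (fun i => f i ∈ cl ω (f j))) ∧
      (∀ ω j, ¬ j < U.card → cl' ω j = {j}) :=
    ⟨fun ω j => if j < U.card then (Finset.range U.card).filter (fun i => f i ∈ cl ω (f j)) else {j},
      fun ω j hj => if_pos hj, fun ω j hj => if_neg hj⟩
  have hmemL' : ∀ ω j, j ∈ L' ω ↔ j < U.card ∧ f j ∈ L ω := fun ω j => by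
    rw [hL', Finset.mem_filter, Finset.mem_range]
  have hmemcl' : ∀ ω j, j < U.card → ∀ i, i ∈ cl' ω j ↔ i < U.card ∧ f i ∈ cl ω (f j) :=
    fun ω j hj i => by rw [hcl'lt ω j hj, Finset.mem_filter, Finset.mem_range]
  -- disjointness transports along `f`
  have hDj : ∀ (X : Finset α) (S : Finset ℕ), (∀ i, i ∈ S ↔ i < U.card ∧ f i ∈ X) →
      ∀ Z' : Finset ℕ, Z' ⊆ Finset.range U.card → (Disjoint Z' S ↔ Disjoint (Z'.image f) X) := by
    intro X S hS Z' hZ'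
    constructor
    · intro hd
      rw [Finset.disjoint_left]
      intro a haZ haX
      obtain ⟨i, hi, rfl⟩ := Finset.mem_image.1 haZ
      exact Finset.disjoint_left.1 hd hi ((hS i).2 ⟨Finset.mem_range.1 (hZ' hi), haX⟩)
    · intro hd
      rw [Finset.disjoint_left]
      intro i hiZ hiS
      exact Finset.disjoint_left.1 hd (Finset.mem_image_of_mem f hiZ) ((hS i).1 hiS).2
  -- Step 4: the block axioms for the compressed system.
  have hself' : ∀ ω ∈ s, ∀ j, j ∈ cl' ω j := by
    intro ω hω j
    by_cases hj : j < U.card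
    · exact (hmemcl' ω j hj j).2 ⟨hj, hselfU ω hω (f j) (hf j hj).1⟩
    · rw [hcl'ge ω j hj]
      exact Finset.mem_singleton_self j
  have hdisj' : ∀ ω ∈ s, ∀ j, j ∉ L' ω → Disjoint (cl' ω j) (L' ω) := by
    intro ω hω j hjL
    by_cases hj : j < U.card
    · have hfj : f j ∉ L ω := fun h => hjL ((hmemL' ω j).2 ⟨hj, h⟩)
      have hd := hdisjU ω hω (f j) (hf j hj).1 hfj
      rw [Finset.disjoint_left]
      intro i hi hiL
      exact Finset.disjoint_left.1 hd ((hmemcl' ω j hj i).1 hi).2 ((hmemL' ω i).1 hiL).2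
    · rw [hcl'ge ω j hj]
      exact Finset.disjoint_singleton_left.2 hjL
  have hblk' : ∀ ω ∈ s, ∀ i j, j ∉ L' ω → i ∈ cl' ω j → cl' ω i = cl' ω j := by
    intro ω hω i j hjL hij
    by_cases hj : j < U.card
    · have hfj : f j ∉ L ω := fun h => hjL ((hmemL' ω j).2 ⟨hj, h⟩)
      obtain ⟨hi, hficl⟩ := (hmemcl' ω j hj i).1 hij
      have hcl : cl ω (f i) = cl ω (f j) := hblkU ω hω (f i) (hf i hi).1 (f j) (hf j hj).1 hfj hficl
      rw [hcl'lt ω i hi, hcl'lt ω j hj, hcl]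
    · rw [hcl'ge ω j hj] at hij
      rw [Finset.mem_singleton.1 hij]
  -- Step 5: the block-exchange hypothesis for the compressed system.
  have hBX' : ∀ m, m < U.card → ∀ (Z : Finset ℕ), Z ⊆ Finset.range m → ∀ h, h < m →
      (∑ ω ∈ s, p ω * (if m ∈ L' ω ∧ h ∉ L' ω ∧ Disjoint Z (L' ω) ∧ ¬ Disjoint Z (cl' ω h) then (1 : ℝ) else 0))
        ≤ ∑ ω ∈ s, p ω * (if m ∉ L' ω ∧ Disjoint Z (cl' ω m) ∧ ¬ Disjoint Z (L' ω) ∧ h ∉ cl' ω m then (1 : ℝ) else 0) := by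
    intro m hm Z' hZ' h hhm
    have hh : h < U.card := hhm.trans hm
    have hfm := hf m hm
    have hfh := hf h hh
    have hZk : Z' ⊆ Finset.range U.card := fun i hi =>
      Finset.mem_range.2 ((Finset.mem_range.1 (hZ' hi)).trans hm)
    have hZsub : Z'.image f ⊆ U.filter (fun a => rank a < rank (f m)) := by
      intro a ha
      obtain ⟨i, hi, rfl⟩ := Finset.mem_image.1 ha
      have him : i < m := Finset.mem_range.1 (hZ' hi)
      have hik : i < U.card := him.trans hm
      refine Finset.mem_filter.2 ⟨(hf i hik).1, hg_rank (f i) (hf i hik).1 (f m) hfm.1 ?_⟩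
      rw [(hf i hik).2, hfm.2]
      exact him
    have hrk : rank (f h) < rank (f m) :=
      hg_rank (f h) hfh.1 (f m) hfm.1 (by rw [hfh.2, hfm.2]; exact hhm)
    have H := hBXU (f m) hfm.1 (Z'.image f) hZsub (f h) hfh.1 hrk
    have e1 : ∀ ω, (m ∈ L' ω ↔ f m ∈ L ω) := fun ω => by
      rw [hmemL']
      exact ⟨fun h' => h'.2, fun h' => ⟨hm, h'⟩⟩
    have e2 : ∀ ω, (h ∈ L' ω ↔ f h ∈ L ω) := fun ω => by
      rw [hmemL']
      exact ⟨fun h' => h'.2, fun h' => ⟨hh, h'⟩⟩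
    have e3 : ∀ ω, (Disjoint Z' (L' ω) ↔ Disjoint (Z'.image f) (L ω)) := fun ω =>
      hDj (L ω) (L' ω) (hmemL' ω) Z' hZk
    have e4 : ∀ ω, (Disjoint Z' (cl' ω h) ↔ Disjoint (Z'.image f) (cl ω (f h))) := fun ω =>
      hDj (cl ω (f h)) (cl' ω h) (hmemcl' ω h hh) Z' hZk
    have e5 : ∀ ω, (Disjoint Z' (cl' ω m) ↔ Disjoint (Z'.image f) (cl ω (f m))) := fun ω =>
      hDj (cl ω (f m)) (cl' ω m) (hmemcl' ω m hm) Z' hZk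
    have e6 : ∀ ω, (h ∈ cl' ω m ↔ f h ∈ cl ω (f m)) := fun ω => by
      rw [hmemcl' ω m hm]
      exact ⟨fun h' => h'.2, fun h' => ⟨hh, h'⟩⟩
    refine le_of_eq_of_le ?_ (H.trans_eq ?_)
    · refine Finset.sum_congr rfl fun ω _ => ?_
      rw [if_congr (and_congr (e1 ω) (and_congr (not_congr (e2 ω)) (and_congr (e3 ω) (not_congr (e4 ω))))) rfl rfl]
    · refine Finset.sum_congr rfl fun ω _ => ?_
      rw [if_congr (and_congr (not_congr (e1 ω)) (and_congr (e5 ω) (and_congr (not_congr (e3 ω)) (not_congr (e6 ω))))) rfl rfl]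
  -- Step 6: the dictionary between the `U`-indexed and the `range #U`-indexed quantities.
  have hPiX : ∀ (X : Finset α) (S : Finset ℕ), (∀ i, i ∈ S ↔ i < U.card ∧ f i ∈ X) →
      (Finset.prod U (fun a => if a ∈ X then (1 : ℝ) - q a else 1))
        = Finset.prod (Finset.range U.card) (fun i => if i ∈ S then (1 : ℝ) - q (f i) else 1) := by
    intro X S hS
    refine Finset.prod_nbij' g f (fun a ha => Finset.mem_range.2 (hg_ltk a ha))
      (fun i hi => (hf i (Finset.mem_range.1 hi)).1) hfg
      (fun i hi => (hf i (Finset.mem_range.1 hi)).2) ?_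
    intro a ha
    have e : g a ∈ S ↔ a ∈ X := by
      rw [hS, hfg a ha]
      exact ⟨fun h => h.2, fun h => ⟨hg_ltk a ha, h⟩⟩
    rw [hfg a ha, if_congr e rfl rfl]
  have hAll : (Finset.prod U (fun a => (1 : ℝ) - q a))
      = Finset.prod (Finset.range U.card) (fun i => (1 : ℝ) - q (f i)) := by
    refine Finset.prod_nbij' g f (fun a ha => Finset.mem_range.2 (hg_ltk a ha))
      (fun i hi => (hf i (Finset.mem_range.1 hi)).1) hfg
      (fun i hi => (hf i (Finset.mem_range.1 hi)).2) ?_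
    intro a ha
    rw [hfg a ha]
  have hW : ∀ a ∈ U, Finset.prod (U.filter (fun a' => rank a < rank a')) (fun a' => (1 : ℝ) - q a')
      = Finset.prod (Finset.Ico (g a + 1) U.card) (fun i => (1 : ℝ) - q (f i)) := by
    intro a ha
    refine Finset.prod_nbij' g f ?_ ?_ ?_ ?_ ?_
    · intro a' ha'
      rw [Finset.mem_filter] at ha'
      exact Finset.mem_Ico.2 ⟨Nat.succ_le_of_lt (hg_lt a ha a' ha'.1 ha'.2), hg_ltk a' ha'.1⟩
    · intro i hi
      rw [Finset.mem_Ico] at hi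
      have hfi := hf i hi.2
      refine Finset.mem_filter.2 ⟨hfi.1, hg_rank a ha (f i) hfi.1 ?_⟩
      rw [hfi.2]
      exact Nat.lt_of_succ_le hi.1
    · intro a' ha'
      exact hfg a' (Finset.mem_filter.1 ha').1
    · intro i hi
      exact (hf i (Finset.mem_Ico.1 hi).2).2
    · intro a' ha'
      rw [hfg a' (Finset.mem_filter.1 ha').1]
  -- Step 7: the Block Star Lemma for the compressed system.
  have key := starLemmaBlocks' s p hp L' cl' hself' hdisj' hblk' (fun j => q (f j)) (fun j => hq0 (f j))
    (fun j => hq1 (f j)) U.card hBX'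
  beta_reduce at key
  -- Step 8: transport back along the bijection.
  refine le_of_eq_of_le ?_ (key.trans_eq ?_)
  · refine Finset.sum_congr rfl fun ω _ => ?_
    rw [hPiX (L ω) (L' ω) (hmemL' ω), hAll]
  · symm
    refine Finset.sum_nbij' g f (fun a ha => Finset.mem_range.2 (hg_ltk a ha))
      (fun i hi => (hf i (Finset.mem_range.1 hi)).1) hfg
      (fun i hi => (hf i (Finset.mem_range.1 hi)).2) ?_
    intro a ha
    rw [hfg a ha, hW a ha]
    congr 1
    refine Finset.sum_congr rfl fun ω _ => ?_
    have hSa : ∀ i, i ∈ cl' ω (g a) ↔ i < U.card ∧ f i ∈ cl ω a := fun i => by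
      rw [hmemcl' ω (g a) (hg_ltk a ha) i, hfg a ha]
    have e : g a ∈ L' ω ↔ a ∈ L ω := by
      rw [hmemL', hfg a ha]
      exact ⟨fun h => h.2, fun h => ⟨hg_ltk a ha, h⟩⟩
    rw [hPiX (L ω) (L' ω) (hmemL' ω), hPiX (cl ω a) (cl' ω (g a)) hSa, if_congr e rfl rfl]

end Summit.CriticalPhenomena.PercolationContinuityZ3.Theorems
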